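import Literature.IUT.HodgeTheaters.KappaCoricRatGaloisRestriction
import Literature.IUT.HodgeTheaters.KappaCoricRatGaloisLocal
import HarnessLib

/-!
# [IUTchI] Example 5.4 (iv), p. 149 — restriction data, companion: `ι_v` on the GEOMETRIC CONSTANTS
# `F̄ ⊂ Λ_{F_mod}` → `K̄_v ⊂ Λ_{K_v}` and the base-change square for GEOMETRIC rational functions
# (cell abc-iut, GAP B = G-L5t9g8-1, item GB-03; seat abc-iut-gapB-03-restrictionData)

S. Mochizuki, *Inter-universal Teichmüller theory I*, kurims manuscript (May 2020), Example 5.4 (iv) p. 149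
(«restriction of associated Kummer classes … `{π₁^{rat}(†𝒟^⊛) ↷ †𝕄^⊛_{∞κ} → ‡𝕄_{∞κv} ⊆ ‡𝕄_{∞κ×v}}_{v∈𝕍}`») and
Remark 3.1.7 (i) p. 66 («a rational function on `L̄_C` … divisor of zeroes and poles over `L̄`»)
([IUTchI] Ex 5.4 (iv) p.149, Rmk 3.1.7 (i) p.66) [claim: Mochizuki2012, status: disputed] (D-0012 claim key;
elementary field theory at print's MODEL presentation; nothing disputed is involved; no side is taken on
[IUTchIII] Cor. 3.12).

## Why (RULINGS #318: divisors are counted GEOMETRICALLY)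

GAP B's local layer (`KappaCoricRatGaloisLocal.lean`, item GB-02) reads `∞κ`-coricity inside `Λ_L =
CriticalLocus.ratClosure L` over the geometric constants `L̄ = CriticalLocus.geomConstants L ⊂ Λ_L` through
`CriticalLocus.geomEmb L : L̄(t) → Λ_L`.  For the base change `ι = RatBaseChange.iota φ : Λ_L → Λ_{L'}` of
`KappaCoricRatGaloisRestriction.lean` (item GB-03) to transport such statements one needs, besides the
`L(t)`-level square `iota_algebraMap`, the square at the GEOMETRIC level.  This file proves it:

* `iota_algebraMap_base` — `ι` is `φ` on the constants `L ⊂ Λ_L`; `iota_ratVar` — `ι t = t`;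
* `IsAlgebraic.iota_base` / `iota_mem_geomConstants` — `ι` maps `L̄ ⊂ Λ_L` into `L̄' ⊂ Λ_{L'}`;
* `iotaConstants φ : geomConstants L →+* geomConstants L'` — the restriction `ι|_{L̄} : L̄ → L̄'` (with
  `coe_iotaConstants`, `iotaConstants_algebraMap`: it is `φ` on `L`);
* `BaseChangeSquare L L' Λ Λ'` — the bundled TYPE of a base-change square (fields `φ, ψ, ψ_C, ψ_X, ι, ι_comm`:
  VERBATIM the shape pinned in the spec sketch `GapSizingBSketch.lean` :47, row GB-03 of `plan/GAP-ITEMS.tsv`), with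
  `BaseChangeSquare.ψ_eq` (the field `ψ` is DETERMINED: `ψ = ratFuncMapCoeffs φ`), and its two canonical terms
  `RatBaseChange.square φ` (the `L(t)`-level square of GB-03's main file) and **`RatBaseChange.geomSquare φ`** (the
  GEOMETRIC square below, over `ι|_{L̄} : L̄ → L̄'` — the form design (B) «arithmetic groups, relative-closure
  divisors» consumes; spec-keeper word 20:54:45Z (3)(ii));
* **`iota_geomEmb`** — THE GEOMETRIC SQUARE `ι (geomEmb_L g) = geomEmb_{L'} (g^{ι|L̄})` for `g ∈ L̄(t)`
  (`ratFuncMapCoeffs (iotaConstants φ)` = coefficient-wise `ι|_{L̄}`, `t ↦ t`), also as an identity of ring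
  homomorphisms (`iota_comp_geomEmb`) and in the `algebraMap` form under the algebra structures
  `(geomEmb _).toRingHom.toAlgebra` that `CriticalLocus.minfkSet` uses (`iota_algebraMap_geom`).

Companion over landed files BY NAME (GB-02's `ratClosure`/`geomConstants`/`ratVar`/`geomEmb` ★ p666689, GB-03's
`iota` ★ p666954, the tree's `ratFuncMapCoeffs`): one `structure` (the ruled TYPE), three `def`s (`iotaConstants`,
`square`, `geomSquare`), theorems; no instance, no notation, no new Prop fact, no `sorry`; the datum-level
one-liner `InitialThetaData.baseChangeSquareAt x := geomSquare (algebraMap F K_x)` waits for GB-02's places file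
(the name of `K_x`) and is the knit's (GB-10) call otherwise; the clause-(a) transport itself (base-change stability of
`∞κ`-coricity) is item GB-06's theorem and the knit's corollary, NOT here; nothing here asserts that abc is
proved or refuted.
-/

namespace Literature.IUT.HodgeTheaters

open Polynomial Literature.FieldTheory.FunctionField
open scoped Polynomial

universe u v w w'

namespace RatBaseChange

open CriticalLocus

variable {L : Type u} {L' : Type v} [Field L] [Field L'] (φ : L →+* L')

/-! ### `ι` on constants and on the coordinate -/

/-- `ι` restricted to the constants `L ⊂ Λ_L` is `φ` (the `L(t)`-square `iota_algebraMap` on `RatFunc.C`).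
([IUTchI] Ex 5.4 (iv) p.149) [claim: Mochizuki2012, status: disputed] -/
theorem iota_algebraMap_base (c : L) :
    iota φ (algebraMap L (ratClosure L) c) = algebraMap L' (ratClosure L') (φ c) := by
  rw [IsScalarTower.algebraMap_apply L (RatFunc L) (ratClosure L), RatFunc.algebraMap_eq_C, iota_algebraMap,
    ratFuncMapCoeffs_C, IsScalarTower.algebraMap_apply L' (RatFunc L') (ratClosure L'), RatFunc.algebraMap_eq_C]

/-- … as an identity of ring homomorphisms `L → Λ_{L'}`. ([IUTchI] Ex 5.4 (iv) p.149)
[claim: Mochizuki2012, status: disputed] -/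
theorem iota_comp_algebraMap_base :
    (iota φ).comp (algebraMap L (ratClosure L)) = (algebraMap L' (ratClosure L')).comp φ :=
  RingHom.ext (iota_algebraMap_base φ)

/-- `ι` fixes the coordinate: `ι (t) = t` (`ψ t = t`). ([IUTchI] Ex 5.4 (iv) p.149)
[claim: Mochizuki2012, status: disputed] -/
theorem iota_ratVar : iota φ (ratVar L) = ratVar L' := by
  rw [ratVar, iota_algebraMap, ratFuncMapCoeffs_X, ratVar]

/-! ### `ι` maps the geometric constants `L̄ ⊂ Λ_L` into `L̄' ⊂ Λ_{L'}` -/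

/-- The geometric constants `L̄ = geomConstants L ⊂ Λ_L` form an algebraically CLOSED field (Mathlib:
`algebraicClosure.isAlgClosure`; recorded as a theorem because `IsAlgClosure.isAlgClosed` is not an instance —
bind it with `haveI` where a `[IsAlgClosed Ω]` hypothesis, e.g. of the geometric clause-(a) theorem, is wanted at
`Ω := geomConstants L`). ([IUTchI] Rmk 3.1.7 (i) p.66) [claim: Mochizuki2012, status: disputed] -/
theorem isAlgClosed_geomConstants : IsAlgClosed (geomConstants L) :=
  IsAlgClosure.isAlgClosed L


/-- An element of `Λ_L` algebraic over the constants `L` is mapped by `ι` to an element algebraic over `L'`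
(apply `ι` to an annihilating polynomial: its `φ`-image annihilates `ι c`).
([IUTchI] Rmk 3.1.7 (i) p.66) [claim: Mochizuki2012, status: disputed] -/
theorem _root_.IsAlgebraic.iota_base {c : ratClosure L} (hc : IsAlgebraic L c) :
    IsAlgebraic L' (iota φ c) := by
  obtain ⟨p, hp0, hp⟩ := hc
  refine ⟨p.map φ, (Polynomial.map_ne_zero_iff φ.injective).mpr hp0, ?_⟩
  rw [Polynomial.aeval_def, Polynomial.eval₂_map, ← iota_comp_algebraMap_base, ← Polynomial.hom_eval₂,
    ← Polynomial.aeval_def, hp, map_zero]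

/-- `ι (L̄) ⊆ L̄'`: the geometric constants are mapped to geometric constants.
([IUTchI] Rmk 3.1.7 (i) p.66) [claim: Mochizuki2012, status: disputed] -/
theorem iota_mem_geomConstants {c : ratClosure L} (hc : c ∈ geomConstants L) :
    iota φ c ∈ geomConstants L' :=
  mem_algebraicClosure_iff.mpr ((mem_algebraicClosure_iff.mp hc).iota_base φ)

/-- **`ι|_{L̄} : L̄ → L̄'`** — the restriction of `ι` to the geometric constants, as a ring homomorphism
`geomConstants L →+* geomConstants L'` (the constant-field part of the restriction data; over it the
geometric critical locus and geometric divisors are transported).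
([IUTchI] Rmk 3.1.7 (i) p.66) [claim: Mochizuki2012, status: disputed] -/
noncomputable def iotaConstants : geomConstants L →+* geomConstants L' where
  toFun c := ⟨iota φ c, iota_mem_geomConstants φ c.2⟩
  map_one' := Subtype.ext (by simp)
  map_mul' x y := Subtype.ext (by simp)
  map_zero' := Subtype.ext (by simp)
  map_add' x y := Subtype.ext (by simp)

/-- `iotaConstants` is `ι` on underlying elements. ([IUTchI] Rmk 3.1.7 (i) p.66)
[claim: Mochizuki2012, status: disputed] -/
@[simp]
theorem coe_iotaConstants (c : geomConstants L) :
    ((iotaConstants φ c : geomConstants L') : ratClosure L') = iota φ c :=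
  rfl

/-- `iotaConstants` is injective. ([IUTchI] Rmk 3.1.7 (i) p.66) [claim: Mochizuki2012, status: disputed] -/
theorem iotaConstants_injective : Function.Injective (iotaConstants φ) :=
  (iotaConstants φ).injective

/-- `iotaConstants` extends `φ`: on `L ⊂ L̄` it is `φ` (so the `L`-rational critical points `S.toGeom` go to
the `L'`-rational points `(φ S).toGeom`). ([IUTchI] Rmk 3.1.7 (i) p.66) [claim: Mochizuki2012, status: disputed] -/
theorem iotaConstants_algebraMap (a : L) :
    iotaConstants φ (algebraMap L (geomConstants L) a) = algebraMap L' (geomConstants L') (φ a) :=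
  Subtype.ext (by
    rw [coe_iotaConstants, IntermediateField.coe_algebraMap_apply, IntermediateField.coe_algebraMap_apply,
      iota_algebraMap_base])

/-! ### The geometric base-change square `ι ∘ geomEmb_L = geomEmb_{L'} ∘ (·)^{ι|L̄}` -/

/-- **The GEOMETRIC base-change square**, as ring homomorphisms `L̄(t) → Λ_{L'}`: `ι ∘ geomEmb_L =
geomEmb_{L'} ∘ ratFuncMapCoeffs (ι|_{L̄})` (both send `t ↦ t` and a constant `c ∈ L̄` to `ι c`; ring maps out of
the fraction field `L̄(t)` of `L̄[t]` agreeing on `L̄[t]` agree).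
([IUTchI] Ex 5.4 (iv) p.149, Rmk 3.1.7 (i) p.66) [claim: Mochizuki2012, status: disputed] -/
theorem iota_comp_geomEmb :
    (iota φ).comp (geomEmb L).toRingHom =
      (geomEmb L').toRingHom.comp (ratFuncMapCoeffs (iotaConstants φ)) := by
  refine IsLocalization.ringHom_ext (nonZeroDivisors (geomConstants L)[X]) (Polynomial.ringHom_ext ?_ ?_)
  · intro c
    simp [geomEmb_C, ratFuncMapCoeffs_C]
  · simp [geomEmb_X, ratFuncMapCoeffs_X, iota_ratVar]

/-- The geometric square, pointwise: `ι (geomEmb_L g) = geomEmb_{L'} (g^{ι|L̄})` for `g ∈ L̄(t)`.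
([IUTchI] Ex 5.4 (iv) p.149, Rmk 3.1.7 (i) p.66) [claim: Mochizuki2012, status: disputed] -/
theorem iota_geomEmb (g : RatFunc (geomConstants L)) :
    iota φ (geomEmb L g) = geomEmb L' (ratFuncMapCoeffs (iotaConstants φ) g) := by
  have h := RingHom.congr_fun (iota_comp_geomEmb φ) g
  simpa using h

/-- The geometric square in the `algebraMap` form, under the (non-instance) algebra structures
`(geomEmb _).toRingHom.toAlgebra` through which `CriticalLocus.minfkSet` / `minfkxSet` read `∞κ`-coricity — the
literal `ι_comm` hypothesis shape of a base-change square `L̄(t) → L̄'(t)`, `Λ_L → Λ_{L'}`.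
([IUTchI] Ex 5.4 (iv) p.149, Rmk 3.1.7 (i) p.66) [claim: Mochizuki2012, status: disputed] -/
theorem iota_algebraMap_geom (g : RatFunc (geomConstants L)) :
    letI : Algebra (RatFunc (geomConstants L)) (ratClosure L) := (geomEmb L).toRingHom.toAlgebra
    letI : Algebra (RatFunc (geomConstants L')) (ratClosure L') := (geomEmb L').toRingHom.toAlgebra
    iota φ (algebraMap (RatFunc (geomConstants L)) (ratClosure L) g) =
      algebraMap (RatFunc (geomConstants L')) (ratClosure L') (ratFuncMapCoeffs (iotaConstants φ) g) :=
  iota_geomEmb φ g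

/-- `ι|_{L̄}` followed by the inclusion `L̄' ⊂ Λ_{L'}` is `ι` restricted to `L̄` (bookkeeping for transports of
`RatFunc.C`-constants). ([IUTchI] Rmk 3.1.7 (i) p.66) [claim: Mochizuki2012, status: disputed] -/
theorem algebraMap_iotaConstants (c : geomConstants L) :
    algebraMap (geomConstants L') (ratClosure L') (iotaConstants φ c) = iota φ (c : ratClosure L) :=
  rfl

end RatBaseChange

/-! ### The bundled TYPE `BaseChangeSquare` (row GB-03, sketch :47) and its two canonical terms -/

/-- **A base-change square** `L(t) → L'(t)`, `Λ → Λ'` over `φ : L → L'` — the bundled TYPE of the restriction data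
(VERBATIM the shape pinned in `GapSizingBSketch.lean` :47 for row D3; intended `L = F_mod`/`F`, `L' = K_v`,
`ι = resKummer` on carriers, or — geometric reading — `L = F̄`, `L' = K̄_v`).  DATA + two equations; nothing of
the series is asserted. ([IUTchI] Ex 5.4 (iv) p.149) [claim: Mochizuki2012, status: disputed] -/
structure BaseChangeSquare (L : Type u) (L' : Type v) (Λ : Type w) (Λ' : Type w') [Field L] [Field L'] [Field Λ]
    [Field Λ'] [Algebra (RatFunc L) Λ] [Algebra (RatFunc L') Λ'] where
  /-- the base field map `F_mod → K_v` -/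
  φ : L →+* L'
  /-- its extension to rational functions -/
  ψ : RatFunc L →+* RatFunc L'
  /-- `ψ` acts as `φ` on constants … -/
  ψ_C : ∀ c, ψ (RatFunc.C c) = RatFunc.C (φ c)
  /-- … and fixes the coordinate `t` -/
  ψ_X : ψ RatFunc.X = RatFunc.X
  /-- the restriction map on carriers (`resKummer`) -/
  ι : Λ →+* Λ'
  /-- compatibility of `ι` with `ψ` -/
  ι_comm : ∀ g, ι (algebraMap (RatFunc L) Λ g) = algebraMap (RatFunc L') Λ' (ψ g)

namespace BaseChangeSquare

variable {L : Type u} {L' : Type v} {Λ : Type w} {Λ' : Type w'} [Field L] [Field L'] [Field Λ] [Field Λ']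
  [Algebra (RatFunc L) Λ] [Algebra (RatFunc L') Λ'] (B : BaseChangeSquare L L' Λ Λ')

/-- The field `ψ` of a base-change square is DETERMINED by `φ`: `ψ = ratFuncMapCoeffs φ` (ring maps out of the
fraction field `L(t)` of `L[t]` agreeing on constants and on `t` agree).
([IUTchI] Ex 5.4 (iv) p.149) [claim: Mochizuki2012, status: disputed] -/
theorem ψ_eq : B.ψ = ratFuncMapCoeffs B.φ := by
  refine IsLocalization.ringHom_ext (nonZeroDivisors L[X]) (Polynomial.ringHom_ext ?_ ?_)
  · intro c
    simp [B.ψ_C, ratFuncMapCoeffs_C]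
  · simp [B.ψ_X, ratFuncMapCoeffs_X]

/-- Hence the square reads `ι (g) = (ratFuncMapCoeffs φ g)` on rational functions.
([IUTchI] Ex 5.4 (iv) p.149) [claim: Mochizuki2012, status: disputed] -/
theorem ι_algebraMap (g : RatFunc L) :
    B.ι (algebraMap (RatFunc L) Λ g) = algebraMap (RatFunc L') Λ' (ratFuncMapCoeffs B.φ g) := by
  rw [B.ι_comm, B.ψ_eq]

end BaseChangeSquare

namespace RatBaseChange

open CriticalLocus

variable {L : Type u} {L' : Type v} [Field L] [Field L'] (φ : L →+* L')

/-- **The `L(t)`-level square of GB-03 as a term of the ruled TYPE**: `(φ, ratFuncMapCoeffs φ, iota φ)` on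
`Λ_L → Λ_{L'}`. ([IUTchI] Ex 5.4 (iv) p.149) [claim: Mochizuki2012, status: disputed] -/
noncomputable def square : BaseChangeSquare L L' (ratClosure L) (ratClosure L') where
  φ := φ
  ψ := ratFuncMapCoeffs φ
  ψ_C := ratFuncMapCoeffs_C φ
  ψ_X := ratFuncMapCoeffs_X φ
  ι := iota φ
  ι_comm := iota_algebraMap φ

/-- The carrier map of `square φ` is `iota φ`. ([IUTchI] Ex 5.4 (iv) p.149) [claim: Mochizuki2012, status: disputed] -/
@[simp] theorem square_ι : (square φ).ι = iota φ := rfl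

/-- The base map of `square φ` is `φ`. ([IUTchI] Ex 5.4 (iv) p.149) [claim: Mochizuki2012, status: disputed] -/
@[simp] theorem square_φ : (square φ).φ = φ := rfl

/-- **The GEOMETRIC square as a term of the ruled TYPE** — base fields the geometric constants `L̄ → L̄'` along
`ι|_{L̄}`, carriers `Λ_L → Λ_{L'}` along `ι`, at the (non-instance) algebra structures `geomEmb` through which
`CriticalLocus.minfkSet` counts divisors (design (B): arithmetic groups `ratGalois`, relative-closure divisors;
both `L̄`, `L̄'` are algebraically closed — Mathlib `IsAlgClosure L (algebraicClosure L _)` — so the geometric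
clause-(a) theorem of item GB-06 applies to THIS square).
([IUTchI] Ex 5.4 (iv) p.149, Rmk 3.1.7 (i) p.66) [claim: Mochizuki2012, status: disputed] -/
noncomputable def geomSquare :
    letI : Algebra (RatFunc (geomConstants L)) (ratClosure L) := (geomEmb L).toRingHom.toAlgebra
    letI : Algebra (RatFunc (geomConstants L')) (ratClosure L') := (geomEmb L').toRingHom.toAlgebra
    BaseChangeSquare (geomConstants L) (geomConstants L') (ratClosure L) (ratClosure L') :=
  letI : Algebra (RatFunc (geomConstants L)) (ratClosure L) := (geomEmb L).toRingHom.toAlgebra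
  letI : Algebra (RatFunc (geomConstants L')) (ratClosure L') := (geomEmb L').toRingHom.toAlgebra
  { φ := iotaConstants φ
    ψ := ratFuncMapCoeffs (iotaConstants φ)
    ψ_C := ratFuncMapCoeffs_C (iotaConstants φ)
    ψ_X := ratFuncMapCoeffs_X (iotaConstants φ)
    ι := iota φ
    ι_comm := iota_algebraMap_geom φ }

/-- The carrier map of `geomSquare φ` is `iota φ`. ([IUTchI] Ex 5.4 (iv) p.149) [claim: Mochizuki2012, status: disputed] -/
theorem geomSquare_ι :
    letI : Algebra (RatFunc (geomConstants L)) (ratClosure L) := (geomEmb L).toRingHom.toAlgebra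
    letI : Algebra (RatFunc (geomConstants L')) (ratClosure L') := (geomEmb L').toRingHom.toAlgebra
    (geomSquare φ).ι = iota φ :=
  rfl

/-- The base map of `geomSquare φ` is `ι|_{L̄} = iotaConstants φ`. ([IUTchI] Ex 5.4 (iv) p.149)
[claim: Mochizuki2012, status: disputed] -/
theorem geomSquare_φ :
    letI : Algebra (RatFunc (geomConstants L)) (ratClosure L) := (geomEmb L).toRingHom.toAlgebra
    letI : Algebra (RatFunc (geomConstants L')) (ratClosure L') := (geomEmb L').toRingHom.toAlgebra
    (geomSquare φ).φ = iotaConstants φ :=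
  rfl

end RatBaseChange

end Literature.IUT.HodgeTheaters
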